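import Mathlib
import HarnessLib
import HarnessLib.Audit
import Summits.AtomisticToContinuum.Statement
import Literature.Analysis.FluidPDE.HardSphereFlowConstruction
import Literature.Analysis.FluidPDE.VectorCalculus

/-!
Route: RoughSpheresKappaDial

CLOSED (retired) 2026-08-15T13:46:22Z by operator:999:1257524 — reason: not-a-thesis: assembly does not conclude the sub-problem Statement — note: D-0027 §2.1 audit (human 2026-08-15: routes that do not decide the summit are removed): the assembly concludes `Literature.MathematicalPhysics.KineticTheory.HydrodynamicLimit`, not the sub-problem statement; a NEW conforming route may be opened from the same idea (generated `closes : … → _root_.Hydr. The file is kept as the record of this route; refuted decls are indexed as negative knowledge (`ledger negatives`).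

# Route RoughSpheresKappaDial — Bryan's rough spheres as a Hamiltonian κ-dial onto hard spheres —
physical spin dice above the window, comparison below it

X = KappaSwapGap ∧ SmallKappaAccuracy ("it suffices to show"), realising card
bryan-rough-spheres-kappa-dial (spine). Replace the
conjunct's smooth spheres by BRYAN–PIDDUCK PERFECTLY ROUGH SPHERES (ChapmanCowling1970 §11.2): same
mass, diameter ε_N = σ(N+1)^(-1/3),
free flight and contacts as the library's collision-by-collision construction
(`Alexander.freeExitTime/incomingPairs`), each sphere carrying
a normalised spin s_i = √(I/m)ω_i ∈ ℝ³ (I = κmε²/4) and colliding by the rule that reverses the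
relative velocity of the contact points —
in normalised form (unit normal k, g = v_i − v_j, g_t its tangential part, S = s_i + s_j): impulse J
= −(g·k)k − κ(1+κ)⁻¹g_t −
√κ(1+κ)⁻¹ k×S on i (−J on j), spin kicks Δs_i = Δs_j = √κ(1+κ)⁻¹ k×g_t + (1+κ)⁻¹ k×(k×S); a linear
isometry of (v_i,v_j,s_i,s_j), an
involution, pair momentum and total energy exact, Liouville ⊗ Lebesgue(spins) invariant, statics
identical to the conjunct's; κ = 0 is
the specular rule (KappaZeroReduction). Along the dial κ_N = r(N+1)^(-1/3): KappaSwapGap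
(COMPARISON, the card's load-bearing conditional
R3) — pre-shock, from the same local Gibbs data (thermal spins at θ₀), the laws of the χ-tested
empirical density/momentum/translational-energy
fields of the deterministic hard-sphere flow and of the rough flow merge as N → ∞ then r → 0;
SmallKappaAccuracy (ENDPOINT) — the rough
gas's fields are within δ of the classical hs-Euler solution for r < r₀(δ) and N large. Then
HydrodynamicLimit is Portmanteau plumbing.
Above the window (κ_N(N+1)^(1/3) → ∞, incl. fixed κ) the spins are Olla–Varadhan–Yau-strength
conservative dice manufactured by rigid-body
mechanics and the limit is the γ = 4/3 Euler system (VanishingKappaEuler, RoughEulerFixedKappa): the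
route's analogue theorems, where the
card's engine (SpinChaos ⇒ contact-Langevin reduction ⇒ ContactLangevinErgodicity, filed informally
after open) is provable-sized.
Lean: `KappaSwapGap ∧ SmallKappaAccuracy`

## Assembly
Portmanteau plumbing, provable now (measure theory over Mathlib; P_N = localGibbsLaw has total mass
0 or 1 by construction of
`canonicalDensity`, so all integrals below are of bounded functions against finite measures): fix
profiles, take σ₀ = min of the two σ₀'s;
for σ < σ₀, a classical solution on [0,T), flows Φ, the t = 0 hypothesis (passed verbatim to both
cruxes), t < T, continuous χ and δ > 0,
let c = ∫χρ_t and F(d,m,e) := min(1, min(δ/2, (|d − c| − δ/2)₊)) (1-Lipschitz for the sup metric, 0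
≤ F ≤ 1). For any η > 0 pick
r < min(r₀^gap(F,η), r₀^acc(δ/2,η)) and N ≥ both N₀(r): min(1,δ/2)·P_N(δ < |density field(Φ_t z) −
c|) ≤ ∫F∘fields∘Φ_t dP_N ≤
∫F∘fields_tr∘R_t d(P_N⊗γ) + η (KappaSwapGap) ≤ min(1,δ/2)·(P_N⊗γ)(δ/2 < |density field(R_t) − c|) +
η ≤ (min(1,δ/2) + 1)η
(SmallKappaAccuracy); η was arbitrary, so P_N(…) → 0; likewise momentum (F of ‖m − ∫χρ_t u_t‖) and
energy. This is TendstoHydroFieldsAt at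
every t < T, i.e. HydrodynamicLimitFor σ for σ < σ₀(profiles), hence the conjunct
(`hydrodynamicLimit_iff`). VanishingKappaEuler,
RoughEulerFixedKappa, RoughWellPosed, KappaZeroReduction and the informal SpinChaos /
ContactLangevinErgodicity / LandauTellerWindow are the
ladder ABOVE the endpoint and enter the conjunct's assembly only as the intended layer-2 route to
SmallKappaAccuracy (stated as such).

Rationale: WHY THIS LINE. The only step of OllaVaradhanYau1993 that uses noise is the ergodic decomposition (§4
(B); FritzFunakiLebowitz1994, LiveraniOlla1996;
barrier MacroErgodicityBarrier), and four cards on the board manufacture "dice inside the collision"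
artificially (AnosovRotorDice,
SpecularLambertianSwap, golf-ball, angular-noise); classical kinetic theory has owned a
deterministic, reversible, Newtonian version since
Bryan 1894 / Pidduck1922 (ChapmanCowling1970 Ch. 11, CondiffLuDahler1965, MccoySandlerDahler1966,
CercignaniLampis1988; rigid-body
collisions as billiard-type maps CoxFeres2016): the spin of a perfectly rough sphere, Gaussian and
independent of everything under every
Gibbs state, kicked by O(1) at every contact and feeding back a tangential impulse of size √κ. The
planner's scaling check (NOTES.md;
ChapmanCowling1970 p. 202: "c small compared with σω but large compared with κσω") shows kick
VARIANCE and translational–rotational energy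
DRIFT are both ≍ κ per collision, hence LOCKED along κ_N(N+1)^(1/3) → r: r → ∞ is exactly OVY's
weak-noise regime (dice per collision → 0,
per unit time → ∞) but equipartition makes the limit the γ = 4/3 gas; r finite is the
two-temperature Euler–Landau–Teller window
(Widom1960 relaxation; ChapmanCowling1970 p. 207 footnote) with sub-OVY dice; r → 0 is the conjunct.
So the line imports stochastic
interacting-particle technology (relative entropy + FFL/LO classification, Lindeberg-CLT for the
accumulated √κ_N feedback) for the
analogue theorems ABOVE the window, and stochastic-stability / law-level comparison of two
deterministic chaotic flows (Kifer1990 class;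
the contact-supported telescoping of SpecularLambertianSwap, MischlerMouhot2012) for the docking
BELOW it — stating honestly that the
endpoint item is conjunct-hard. What no open route does: a HAMILTONIAN comparison gas with the
conjunct's own statics and phase-space
geometry whose distance to the specular flow is an explicit mechanical parameter (VanishingNoise:
external Markov noise; SpecularLambertianSwap:
Markov comparison gas at O(1) distance; SoftShoulderLandauDial: changes the statics;
AnosovRotorDice: designed rotors, Hopf machine).
Negatives index empty (2026-08-15).

RANKED CRUXES. #2 KappaSwapGap (crux) — COMPARISON / STOCHASTIC STABILITY (card R3, the load-bearing
conditional, layer-1 form; the loaded-sphere channel of card loaded-dice-jeans-spheres can attach by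
restating with its flow). For continuous profiles ∃ σ₀ ∀ σ < σ₀, every classical hs-Euler solution
on [0,T), every family of hard-sphere flows Φ_N with local Gibbs laws P_N whose fields converge at t
= 0: for every t < T, continuous χ, 1-Lipschitz F of the three χ-tested fields with |F| ≤ 1 and η >
0 there is r₀ > 0 such that for every r ∈ (0,r₀), for N ≥ N₀(r): |E_(P_N) F(fields(Φ_N,t z)) −
E_(P_N⊗γ) F(fields_tr(R^κ_N,t(z, √θ₀(x_i)ξ_i)))| ≤ η, κ_N = r(N+1)^(-1/3), R^κ the rough flow
(inline `let` block: rpair = Bryan's rule above on Cfg N × (Fin (N+1) → ℝ³), rstep = free flight to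
`Alexander.freeExitTime` then rpair on the incoming contact pair, rstate/rinst/rflow its iteration
exactly as `Alexander.stateAfter/collisionInstant/fwdFlow`, spinLaw = `Measure.pi` of standard
Gaussians, init = spins √θ₀(x_i)·ξ_i). [difficulty: open-problem] (why it might fail: the flows
decorrelate pathwise after O(1) collisions (Lyapunov rate ≍ N^(1/3)); law-level merging of the
fields is stochastic stability of hs-Euler statistics under O(√r·N^(-1/6)) contact kicks — unproved
for any chaotic N-body flow; an O(ρσ³) ring bias could survive r → 0.) [Kifer1990,
MischlerMouhot2012, OllaVaradhanYau1993, ChapmanCowling1970, doi:10.3934/krm.2018008]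
#5 VanishingKappaEuler (crux) — THE OVY-REGIME ANALOGUE THEOREM — Euler for asymptotically smooth
rough spheres (sharpening of card rung R1 found by the scaling check). For every sequence κ_N > 0
with κ_N → 0 and κ_N(N+1)^(1/3) → ∞ (tangential feedback per collision O(√κ_N) → 0, accumulated kick
variance and energy-exchange count per unit time ≍ κ_N(N+1)^(1/3) → ∞ — Olla–Varadhan–Yau's
weak-noise scaling realised by mechanics), all continuous profiles, ∃ σ₀ ∀ σ < σ₀: for every
classical solution on [0,T) of the γ = 4/3 hard-sphere Euler system (mass; momentum with p =
hsPressure σ ρ θ; energy with E = ρ(|u|²/2 + 3θ), written inline in the torus calculus) and rough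
local Gibbs data (P_N ⊗ thermal spins at θ₀) whose translational fields converge at t = 0, the
empirical density, momentum and TRANSLATIONAL kinetic-energy fields of the rough flow R^(κ_N)
converge in probability at every t < T to ρ_t, ρ_t u_t and ρ_t(|u_t|²/2 + 3θ_t/2) (equipartition).
[difficulty: open-problem] (why it might fail: needs SpinChaos in CLT form (accumulated √κ_N
k×(s_i+s_j) feedback = Gaussian contact noise given the translational past), zero-friction
ContactLangevinErgodicity, cubic tails (HighMomentumCutoff) and fast equipartition; ring-correlated
spins at positive ρσ³ may bias the dice.) [OllaVaradhanYau1993, FritzFunakiLebowitz1994,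
LiveraniOlla1996, ChapmanCowling1970, OdellBerne1975, CondiffLuDahler1965]
#6 SmallKappaAccuracy (crux) — ENDPOINT RUNG (card R3's second half, accuracy form — the
Euler–Landau–Teller window read at small r through continuous dependence of classical relaxation
solutions on r, so no new PDE notion is needed). Same frame as KappaSwapGap; conclusion: for every t
< T, continuous χ, δ > 0 and η > 0 there is r₀ > 0 such that for r ∈ (0,r₀) and N ≥ N₀(r), under P_N
⊗ γ the probability that the χ-tested empirical density (resp. momentum, translational energy) field
of R^(κ_N)_t, κ_N = r(N+1)^(-1/3), deviates by more than δ from ∫χρ_t (resp. ∫χρ_t u_t, ∫χE_t with E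
= ρ(|u|²/2 + 3θ/2), the CONJUNCT's hs-Euler solution) is ≤ η. [difficulty: open-problem] (why it
might fail: at κ_N = r(N+1)^(-1/3) the spin dice are sub-OVY (kick variance O(r) per particle per
unit time, zero microscopic rate): neither FFL/LO nor OVY's Dirichlet-form step applies, the ergodic
input must come from the deterministic collisions — conjunct-hard at small r.) [OllaVaradhanYau1993,
Widom1960, ChenLevermoreLiu1994, ChapmanCowling1970,
Literature.Barriers.AtomisticToContinuum.MacroErgodicityBarrier]
#9 RoughEulerFixedKappa (support) — ANALOGUE THEOREM AT FIXED ROUGHNESS (card rung R1; support — it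
does not drive staffing, VanishingKappaEuler does): for every κ ∈ (0, 2/3] and continuous profiles ∃
σ₀ ∀ σ < σ₀: γ = 4/3 hard-sphere Euler (inline clauses as in VanishingKappaEuler) from the
deterministic rough-sphere flow R^κ with rough local Gibbs data, pre-shock, convergence in
probability of density, momentum and translational-energy fields (the latter to ρ(|u|²/2 + 3θ/2)).
Expected proof: SpinChaos (fixed-κ form) ⇒ contact-Langevin reduction ⇒ ContactLangevinErgodicity ⇒
OVY §4 (C)–(E) + relative-entropy bookkeeping with contact currents, EOS from the conjunct's statics
(VirialEosIdentification 0782, LocalGibbsConcentration 0767 apply verbatim: same excluded volume).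
[difficulty: open-problem] [ChapmanCowling1970, CondiffLuDahler1965, OllaVaradhanYau1993,
FritzFunakiLebowitz1994, CoxFeres2016]
#9 RoughWellPosed (support) — ALEXANDER'S THEOREM FOR THE ROUGH FLOW (every κ ≥ 0, 0 < σ < 1/2,
every N): (a) p ↦ R^κ_t p is measurable for each t; (b) for Liouville ⊗ Lebesgue-a.e. (z, s) every
finite exit configuration of the rough recursion is a simple incoming collision, no pair touches
strictly inside a free flight, and the exit times sum to ∞ (the three `FwdGood` clauses for rstate);
(c) R^κ_t preserves Liouville ⊗ Lebesgue(spins) for t ≥ 0. Same proof as `torusFlow_ae_good_holds` /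
`torusFlow_measurePreserving_holds` (CIP1994 App. 4.A): the rule is a linear isometry of
(v_i,v_j,s_i,s_j) reversing g·k, so it maps the incoming flux measure |g·k| dS dv ds onto the
outgoing one; note the map is DIScontinuous at grazing (ChapmanCowling1970 §11.8), which the measure
argument does not mind. [difficulty: M] [CIP1994, GST2013, ChapmanCowling1970, CoxFeres2016]
#9 KappaZeroReduction (support) — UNIT TEST OF THE DIAL'S ENDPOINT (provable now, by unfolding and
induction on the collision index): at κ = 0 the typed rule is J = −(g·k)k = `collidePair` on the
translational variables and the spin update does not feed back, so the translational projection of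
R^0 is the library's `Alexander.fwdFlow` for every σ, N, initial (z, s) and t (same branching on
`freeExitTime = ⊤` / `incomingPairs`, same `Set.Nonempty.some`). [difficulty: provable-now]
[CIP1994, ChapmanCowling1970]

TWO-LAYER PLAN. Foreseen glued splits (k ≤ 3, depth 1), nothing filed now. VanishingKappaEuler ⇐
SpinChaosCLT (SpinChaos (b), typed once D1 lands) →
ZeroFrictionContactErgodicity (ContactLangevinErgodicity, γ → 0 form, typed once D2–D3 land) →
OVYBookkeepingRough (relative entropy with
contact currents, conjunct's EOS, cubic tails = EnergyCurrentTails 3655 restated for R^κ) →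
VanishingKappaEuler. SmallKappaAccuracy ⇐
LandauTellerWindow (all r ∈ (0,r₁)) → RelaxationContinuity (classical Euler–Landau–Teller solutions
with well-prepared data θ_rot = θ_tr
depend continuously on r at r = 0 on [0,t], ChenLevermoreLiu1994 structure; PDE, provable with a
local well-posedness theory) →
SmallKappaAccuracy. KappaSwapGap ⇐ RoughSwapIdentity (the contact-supported telescoping identity of
SpecularLambertianSwap's SwapIdentity
with the rough continuation in place of the Lambertian one — both gases share free flight and exit
times given the translational state, so
it is again exact) → RoughLinearResponse (influence of one O(√κ_N) tangential kick on the future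
tested fields is O(√κ_N·N^(-1)) in mean,
summable against ≍ σ²N^(4/3) contacts only after averaging the sign of k×S: a martingale, not a
Gronwall, structure) → KappaSwapGap.

KILL CRITERIA. (1) ¬KappaSwapGap — e.g. event-driven MD showing the block-field gap between HS and
rough spheres at κ = rN^(-1/3) from identical local-Gibbs
samples NOT decreasing as r ↓ 0 at fixed large N, or a proof that an O(ρσ³) field bias survives —
closes the route `refuted:KappaSwapGap`
and retires the docking of every Hamiltonian-dial card (loaded-dice, golf-ball, soft-shoulder,
einstein-bath) with the same witness.
(2) ¬VanishingKappaEuler with SpinChaos intact (a non-Gibbs regular stationary state of the infinite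
hard-sphere flow invariant under
Gaussian tangential contact kicks) refutes ContactLangevinErgodicity's zero-friction form: pivot the
analogue rung to fixed κ
(RoughEulerFixedKappa) or close `refuted:VanishingKappaEuler` if that dies too. (3) ¬SpinChaos at
fixed κ (persistent O(1) spin–velocity
correlation of colliding pairs out of equilibrium, OdellBerne1975-type) demotes the card's engine;
the route survives on KappaSwapGap +
SmallKappaAccuracy only if (1) stands — else close. (4) ¬SmallKappaAccuracy refutes, through
KappaSwapGap, the conjunct itself (hand the
witness to the negatives index). Mooted: HydrodynamicLimit proved by any entropy route moots
SmallKappaAccuracy's role but leaves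
KappaSwapGap / VanishingKappaEuler independently wanted; GibbsErgodicity (0779) proved makes
ContactLangevinErgodicity a corollary.

NOT DECOMPOSED YET. SpinChaos (rank 3) and ContactLangevinErgodicity (rank 4) are filed INFORMAL
right after open (they need D1–D3) and typed by
set-signature when the definitions land; LandauTellerWindow (support, informal; needs D4) likewise.
Not decomposed: the exchange
coefficient c(ρσ³, θ) of the window system (κ → 0 limit of κ⁻¹ × the Pidduck/Widom/Condiff–Lu–Dahler
relaxation frequency times the
contact value Y(ρσ³)); velocity/spin tail truncations (EnergyCurrentTails 3655 restated for R^κ,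
plus the rotational current
v|s|²/2 of the same cubic type); the equipartition layer (θ_rot → θ_tr on times ≍ (κ_N N^(1/3))⁻¹);
the contact-current form of the
virial EOS for rough collisions (normal impulse unchanged ⇒ same hsPressure; tangential impulses
average out — to be checked in
OVYBookkeepingRough); the N + 1 = 2 unit test of RoughSwapIdentity; smooth-vs-continuous χ
approximations (layer-2 support).

CHEAPEST FALSIFIER. (i) ALGEBRA, done here (pure python, NOTES.md): the normalised rule conserves
Σ|v|²+|s|² and momentum exactly, reverses the contact
velocity, is an involution, is specular at κ = 0, and gives tangential velocity kicks
1.20/0.23/0.004 thermal units at κ = 0.4/0.05/10⁻⁴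
(≍ √κ) with O(1) spin kicks — the locking of dice strength and energy exchange that shapes the route
(consistency check, not a kill).
(ii) Decisive cheap experiment (kit, not run here): event-driven MD of elastic rough spheres, φ =
0.05–0.1, N = 10³–10⁵: (a) block-field
gap HS vs rough at κ = rN^(-1/3) from identical local-Gibbs samples (shear + temperature wave)
versus r and N — must decrease as r ↓ 0
uniformly in N (KappaSwapGap); (b) T_tr − T_rot relaxation time versus κN^(1/3) — crossover at κ ≍
Kn (window); (c) spin–velocity and
partner-spin correlations of colliding pairs under uniform shear at fixed κ — an O(1),
Kn-independent correlation kills SpinChaos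
(OdellBerne1975 saw molecular-chaos deviations only at liquid densities). (iii) Lookup done:
ChapmanCowling1970 §11.8 — rough collisions
are discontinuous at grazing; harmless for RoughWellPosed (measure argument), relevant to any
standard-pair use.

NUMBERS. Fixed reduced density (N+1)ε³ = σ³; ≍ σ²(N+1)^(1/3) collisions per sphere per unit time.
Bryan's rule (ChapmanCowling1970 11.2 (1)–(10)),
κ = 4I/mε² ∈ (0, 2/3] (2/5 uniform ball, 2/3 shell). Per collision with thermal spins: tangential
velocity kick ≍ √κ·v_th, translational
energy change ≍ √κ·θ (random sign), systematic T_tr–T_rot exchange ≍ κ(θ_tr − θ_rot), spin kick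
O(1): kick variance rate = exchange rate
≍ κ_N σ²(N+1)^(1/3) =: r·σ². Regimes: r → ∞ ⇒ one temperature, e = 3θ, γ = 4/3 (ChapmanCowling1970
p. 207); r → 0 ⇒ γ = 5/3 + passive
spins; r ∈ (0,∞) ⇒ Euler–Landau–Teller. OVY's noise: intensity θ(ε) → ∞ with εθ(ε) → 0
(OllaVaradhanYau1993 §2.1) ⇔ here κ_N → 0 with
κ_N N^(1/3) → ∞ (VanishingKappaEuler). Rough-vs-smooth first-approximation conductivity ratio 1.480
at κ → 0 (ChapmanCowling1970 p. 214:
the limits κ → 0 and Kn → 0 do not commute). Items at open: 7 (3 cruxes typed + 3 supports +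
assembly); after the informal adds: 10.

DEFINITION REQUESTS. D1 `RoughSphereFlow` API (topic
Summits/AtomisticToContinuum/HydrodynamicLimit/Theorems; new object posited for this problem): named
definitions `roughPair κ`, `roughStep`, `roughStateAfter`, `roughInstant`, `roughFlow`, `spinLaw`,
`roughInit` — verbatim the `let` block
of KappaSwapGap — plus the empirical collision/spin measures needed to type SpinChaos;
existence/measure preservation is the separate
support RoughWellPosed (never smuggled into the interface). D2 `ContactLangevinGas` (same topic):
the Markov hard-sphere dynamics with the
spin-marginalised Bryan rule (J = −(g·k)k − κ(1+κ)⁻¹g_t − √κ(1+κ)⁻¹ k×Σ, Σ ~ N(0, 2θ_b·Id) fresh at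
each contact), finite N on 𝕋³ by the
ξ-driven collision recursion (as SpecularLambertianSwap's Lambertian API) and infinite volume via
D3. D3 `RegularStationaryState` (topic
Literature/MathematicalPhysics/KineticTheory): translation-invariant stationary states of
Alexander's a.s. infinite-volume (marked)
hard-sphere dynamics with finite density/energy and specific entropy — the same request as
AnosovRotorDice's D3 and GibbsErgodicity 0779.
D4 `IsLandauTellerEulerSolution σ r T ρ u θ_tr θ_rot` (topic
Literature/MathematicalPhysics/KineticTheory): classical solutions of the
two-temperature Euler system with relaxation source, to type LandauTellerWindow. No cite facts
needed.

Novelty: Searches (2026-08-15): `lit frontier AtomisticToContinuum --since 2020` (30 rows; only deterministic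
macroscopic limit:
CanestrariLiveraniOlla2026 = arXiv:2310.13338, diffusive); `lit bridges AtomisticToContinuum --cross
any` (30 rows, nothing on
internal-state gases); `lit search --source crossref` ×5 — "rough spheres kinetic theory rotational
translational temperature relaxation
hydrodynamics" (12: HuthmannZippelius1997, Widom1960, doi:10.1515/jnet.1986.11.3-4.145,
granular/inelastic rest), "rough sphere gas Enskog
hydrodynamic equations … Kremer Santos" (12: doi:10.1007/s10955-024-03269-w inelastic rough Maxwell,
doi:10.1063/1.441099), "rough hard
sphere fluid molecular dynamics spin velocity correlation Berne" (10: OdellBerne1975,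
PangaliBerne1977, doi:10.1063/1.434355), "zero noise
limit hydrodynamic limit Hamiltonian small stochastic perturbation" (10, nothing relevant),
"Landau-Teller relaxation two-temperature Euler
relaxation limit" (10: doi:10.1007/s00030-012-0159-0, doi:10.1016/j.jde.2015.11.034 — PDE relaxation
limits only); `lit galaxy search
"perfectly rough spheres" --star all` (9 panama: Hirschfelder–Curtiss–Bird, Ferziger–Kaper, CC; pdf:
Kremer's Boltzmann book) and
`"rough spherical molecules" --star all` (6 panama incl. both CC editions, Cercignani CISM 293; 2
pdf); `lit read` ChapmanCowling1970
pp. 199–218 (held; §11.2 rule, κ → 0 remark, γ = 4/3, §11.8); local `lit search --hybrid` down this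
session (searchd exit 75, logged).
Plus the card's two refuter a  [refs: 10.1515/jnet.1986.11.3-4.145, 10.1007/s10955-024-03269-w, 10.1063/1.441099, 10.1063/1.434355, 10.1007/s00030-012-0159-0, 10.1016/j.jde.2015.11.034, 2310.13338, doi:10.1515/jnet.1986.11.3-4.145, doi:10.1007/s10955-024-03269-w, doi:10.1063/1.441099, doi:10.1063/1.434355, doi:10.1007/s00030-012-0159-0, doi:10.1016/j.jde.2015.11.034, CanestrariLiveraniOlla2026, HuthmannZippelius1997, Widom1960, OdellB]

Barriers (technique_class: hamiltonian-dial internal-dof rel-entropy stoch-stability): - technique_class: hamiltonian-dial internal-dof rel-entropy stoch-stability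
- Literature.Barriers.AtomisticToContinuum.BoltzmannHypothesisBarrier: for the analogue rungs
(VanishingKappaEuler, RoughEulerFixedKappa) the classification input is REPLACED, given SpinChaos,
by invariance under a conservative contact noise (the catalogue's own evasion "add conservative
noise", realised by mechanics); for the conjunct nothing is evaded — SmallKappaAccuracy carries the
weight and says so. Kernel respected: with no collisions the spins are never read, the rough and
smooth free flights coincide, KappaSwapGap holds trivially and SmallKappaAccuracy fails, correctly.
- Literature.Barriers.AtomisticToContinuum.BoltzmannHypothesisBarrierNarrow: same slot; the
flux-level closure for the rough gas is what OVYBookkeepingRough must supply from the contact-noise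
invariance, not assumed.
- Literature.Barriers.AtomisticToContinuum.MacroErgodicityBarrier: its evasion (a) is
ContactLangevinErgodicity's class; conceded that FFL's printed scope (bounded V″) does not cover
hard cores and that the noise is contact-supported (shared with SpecularLambertianSwap's
LambertianEuler); below the window it is not evaded (the bet is named: SmallKappaAccuracy).
- Literature.Barriers.AtomisticToContinuum.HighMomentumCutoffBarrier: it does not evade it; cubic
translational AND rotational energy currents need the same uniform integrability (EnergyCurrentTails
3655 restated) — flagged in VanishingKappaEuler's why-lin

History (route lifecycle, newest last):
- 2026-08-15T13:46:22Z · CLOSED retired — not-a-thesis: assembly does not conclude the sub-problem Statement (operator:999:1257524)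

sub-problem: HydrodynamicLimit · status: closed(retired) · opened planner-plancard-AtomisticToContinuum-Hydrody-24247dcf-0 2026-08-15T12:13:36Z · rev 0 · ledger route-AtomisticToContinuum-RoughSpheresKappaDial
GENERATED by the gate from the ledger (D-0016/17). Provers cite these decls: `theorem foo : Summit.AtomisticToContinuum.HydrodynamicLimit.Theses.RoughSpheresKappaDial.<Decl> := …` in Summits/AtomisticToContinuum/HydrodynamicLimit/Theorems/<Name>.lean.
-/

namespace Summit.AtomisticToContinuum.HydrodynamicLimit.Theses.RoughSpheresKappaDial

open scoped BigOperators Topology Manifold Classical MeasureTheory ProbabilityTheory Matrix InnerProductSpace ComplexConjugate ContinuousMap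
open Filter Set Function TopologicalSpace MeasureTheory

attribute [summit_statement] _root_.HydrodynamicLimit

/-- item stmt-AtomisticToContinuum-7648 · crux · rank 2 · closed · moot by None · by planner
why it might fail: the flows decorrelate pathwise after O(1) collisions (Lyapunov rate ≍ N^(1/3)); law-level merging of the fields is stochastic stability of hs-Euler statistics under O(√r·N^(-1/6)) contact kicks — unproved for any chaotic N-body flow; an O(ρσ³) ring bias could survive r → 0.
sources: Kifer1990, MischlerMouhot2012, OllaVaradhanYau1993, ChapmanCowling1970, doi:10.3934/krm.2018008
[crux] COMPARISON / STOCHASTIC STABILITY (card R3, the load-bearing conditional, layer-1 form; the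
loaded-sphere channel of card loaded-dice-jeans-spheres can attach by restating with its flow). For
continuous profiles ∃ σ₀ ∀ σ < σ₀, every classical hs-Euler solution on [0,T), every family of
hard-sphere flows Φ_N with local Gibbs laws P_N whose fields converge at t = 0: for every t < T,
continuous χ, 1-Lipschitz F of the three χ-tested fields with |F| ≤ 1 and η > 0 there is r₀ > 0 such
that for every r ∈ (0,r₀), for N ≥ N₀(r): |E_(P_N) F(fields(Φ_N,t z)) − E_(P_N⊗γ)
F(fields_tr(R^κ_N,t(z, √θ₀(x_i)ξ_i)))| ≤ η, κ_N = r(N+1)^(-1/3), R^κ the rough flow (inline `let`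
block: rpair = Bryan's rule above on Cfg N × (Fin (N+1) → ℝ³), rstep = free flight to
`Alexander.freeExitTime` then rpair on the incoming contact pair, rstate/rinst/rflow its iteration
exactly as `Alexander.stateAfter/collisionInstant/fwdFlow`, spinLaw = `Measure.pi` of standard
Gaussians, init = spins √θ₀(x_i)·ξ_i). [difficulty: open-problem] -/
@[route_item "route-AtomisticToContinuum-RoughSpheresKappaDial"]
def KappaSwapGap : Prop :=
  open Filter MeasureTheory ProbabilityTheory Literature.Analysis.FluidPDE Literature.MathematicalPhysics.KineticTheory Literature.Analysis.FunctionSpaces in let Cfg : ℕ → Type := fun N => Config (N + 1) (Fin 3) T3; let Spin : ℕ → Type := fun N => Fin (N + 1) → V3; let G := Torus.geometry (Fin 3); let ε : ℝ → ℕ → ℝ := hsDiameter; let τ : ℝ → (N : ℕ) → Cfg N → ENNReal := fun σ N z => Alexander.freeExitTime G (ε σ N) z; let S : ℝ → (N : ℕ) → Cfg N → Cfg N := fun t _ z => freeFlight G t z; let rpair : ℝ → (N : ℕ) → Fin (N + 1) → Fin (N + 1) → Cfg N × Spin N → Cfg N × Spin N := fun κ _ i j p => let z := p.1; let s := p.2;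 let n := G.sepVec (z i).1 (z j).1; let k := ‖n‖⁻¹ • n; let g := (z i).2 - (z j).2; let gt := g - (⟪g, k⟫_ℝ) • k; let S2 := s i + s j; let J := -((⟪g, k⟫_ℝ) • k) - (κ / (1 + κ)) • gt - (Real.sqrt κ / (1 + κ)) • cross k S2; let ds := (Real.sqrt κ / (1 + κ)) • cross k gt + (1 / (1 + κ)) • cross k (cross k S2); (Function.update (Function.update z i ((z i).1, (z i).2 + J)) j ((z j).1, (z j).2 - J), Function.update (Function.update s i (s i + ds)) j (s j + ds)); let rstep : ℝ → ℝ → (N : ℕ) → Cfg N × Spin N → Cfg N × Spin N := fun κ σ N p => let z' := S (τ σ N p.1).toReal N p.1; if τ σ N p.1 = ⊤ then p else if h : (Alexander.incomingPairs G (ε σ N) z').Nonempty then rpair κ N h.some.1 h.some.2 (z', p.2) else (z', p.2); let rstate : ℝ → ℝ → (N : ℕ) → Cfg N × Spin N → ℕ → Cfg N × Spin N := fun κ σ N p k => (rstep κ σ N)^[k] p; let rinst : ℝ → ℝ → (N : ℕ) → Cfg N × Spin N → ℕ → ENNReal := fun κ σ N p k => ∑ m ∈ Finset.range k, τ σ N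 (rstate κ σ N p m).1; let rflow : ℝ → ℝ → (N : ℕ) → Cfg N × Spin N → ℝ → Cfg N × Spin N := fun κ σ N p t => let K := sSup {k : ℕ | rinst κ σ N p k ≤ ENNReal.ofReal t}; (S (t - (rinst κ σ N p K).toReal) N (rstate κ σ N p K).1, (rstate κ σ N p K).2); let spinLaw : (N : ℕ) → Measure (Spin N) := fun N => Measure.pi (fun _ : Fin (N + 1) => stdGaussian V3); let init : (T3 → ℝ) → (N : ℕ) → Cfg N × Spin N → Cfg N × Spin N := fun θ₀ _ p => (p.1, fun i => Real.sqrt (θ₀ (p.1 i).1) • p.2 i); let fld : (N : ℕ) → Cfg N → (T3 → ℝ) → ℝ × V3 × ℝ := fun _ z χ => (empiricalDensityField z χ, empiricalMomentumField z χ, empiricalEnergyField z χ); ∀ (a₀ θ₀ : T3 → ℝ) (u₀ : T3 → V3), Continuous a₀ → Continuous θ₀ → Continuous u₀ → (∀ x, 0 < a₀ x) → (∀ x, 0 < θ₀ x) → ∃ σ₀ : ℝ, 0 < σ₀ ∧ ∀ σ : ℝ, 0 < σ → σ < σ₀ → ∀ (T : ℝ) (ρ θ : ℝ → T3 → ℝ)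 (u : ℝ → T3 → V3), IsHardSphereEulerSolution σ T ρ u θ → ∀ Φ : (N : ℕ) → HardSphereFlow G (ε σ N) (N + 1), let P := fun N => localGibbsLaw σ a₀ u₀ θ₀ N (Φ N); TendstoHydroFieldsAt P Φ ρ u θ 0 → ∀ t ∈ Set.Ico 0 T, ∀ χ : T3 → ℝ, Continuous χ → ∀ F : ℝ × V3 × ℝ → ℝ, LipschitzWith 1 F → (∀ y, |F y| ≤ 1) → ∀ η : ℝ, 0 < η → ∃ r₀ : ℝ, 0 < r₀ ∧ ∀ r : ℝ, 0 < r → r < r₀ → ∃ N₀ : ℕ, ∀ N : ℕ, N₀ ≤ N → |(∫ z, F (fld N ((Φ N).flow t z) χ) ∂(P N)) - ∫ p, F (fld N (rflow (r * ((N : ℝ) + 1) ^ (-(1 / 3 : ℝ))) σ N (init θ₀ N p) t).1 χ) ∂((P N).prod (spinLaw N))| ≤ η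

/-- item stmt-AtomisticToContinuum-7649 · crux · rank 5 · closed · moot by None · by planner
why it might fail: needs SpinChaos in CLT form (accumulated √κ_N k×(s_i+s_j) feedback = Gaussian contact noise given the translational past), zero-friction ContactLangevinErgodicity, cubic tails (HighMomentumCutoff) and fast equipartition; ring-correlated spins at positive ρσ³ may bias the dice.
sources: OllaVaradhanYau1993, FritzFunakiLebowitz1994, LiveraniOlla1996, ChapmanCowling1970, OdellBerne1975, CondiffLuDahler1965
[crux] THE OVY-REGIME ANALOGUE THEOREM — Euler for asymptotically smooth rough spheres (sharpening
of card rung R1 found by the scaling check). For every sequence κ_N > 0 with κ_N → 0 and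
κ_N(N+1)^(1/3) → ∞ (tangential feedback per collision O(√κ_N) → 0, accumulated kick variance and
energy-exchange count per unit time ≍ κ_N(N+1)^(1/3) → ∞ — Olla–Varadhan–Yau's weak-noise scaling
realised by mechanics), all continuous profiles, ∃ σ₀ ∀ σ < σ₀: for every classical solution on
[0,T) of the γ = 4/3 hard-sphere Euler system (mass; momentum with p = hsPressure σ ρ θ; energy with
E = ρ(|u|²/2 + 3θ), written inline in the torus calculus) and rough local Gibbs data (P_N ⊗ thermal
spins at θ₀) whose translational fields converge at t = 0, the empirical density, momentum and
TRANSLATIONAL kinetic-energy fields of the rough flow R^(κ_N) converge in probability at every t < T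
to ρ_t, ρ_t u_t and ρ_t(|u_t|²/2 + 3θ_t/2) (equipartition). [difficulty: open-problem] -/
@[route_item "route-AtomisticToContinuum-RoughSpheresKappaDial"]
def VanishingKappaEuler : Prop :=
  open Filter MeasureTheory ProbabilityTheory Literature.Analysis.FluidPDE Literature.MathematicalPhysics.KineticTheory Literature.Analysis.FunctionSpaces in let Cfg : ℕ → Type := fun N => Config (N + 1) (Fin 3) T3; let Spin : ℕ → Type := fun N => Fin (N + 1) → V3; let G := Torus.geometry (Fin 3); let ε : ℝ → ℕ → ℝ := hsDiameter; let τ : ℝ → (N : ℕ) → Cfg N → ENNReal := fun σ N z => Alexander.freeExitTime G (ε σ N) z; let S : ℝ → (N : ℕ) → Cfg N → Cfg N := fun t _ z => freeFlight G t z; let rpair : ℝ → (N : ℕ) → Fin (N + 1) → Fin (N + 1) → Cfg N × Spin N → Cfg N × Spin N := fun κ _ i j p => let z := p.1; let s := p.2; let n := G.sepVec (z i).1 (z j).1; let k := ‖n‖⁻¹ • n; let g := (z i).2 - (z j).2; let gt := g - (⟪g, k⟫_ℝ) • k; let S2 := s i + s j; let J := -((⟪g, k⟫_ℝ) • k) -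 (κ / (1 + κ)) • gt - (Real.sqrt κ / (1 + κ)) • cross k S2; let ds := (Real.sqrt κ / (1 + κ)) • cross k gt + (1 / (1 + κ)) • cross k (cross k S2); (Function.update (Function.update z i ((z i).1, (z i).2 + J)) j ((z j).1, (z j).2 - J), Function.update (Function.update s i (s i + ds)) j (s j + ds)); let rstep : ℝ → ℝ → (N : ℕ) → Cfg N × Spin N → Cfg N × Spin N := fun κ σ N p => let z' := S (τ σ N p.1).toReal N p.1; if τ σ N p.1 = ⊤ then p else if h : (Alexander.incomingPairs G (ε σ N) z').Nonempty then rpair κ N h.some.1 h.some.2 (z', p.2) else (z', p.2); let rstate : ℝ → ℝ → (N : ℕ) → Cfg N × Spin N → ℕ → Cfg N × Spin N := fun κ σ N p k => (rstep κ σ N)^[k] p; let rinst : ℝ → ℝ → (N : ℕ) → Cfg N × Spin N → ℕ → ENNReal := fun κ σ N p k => ∑ m ∈ Finset.range k, τ σ N (rstate κ σ N p m).1; let rflow : ℝ → ℝ → (N : ℕ) → Cfg N × Spin N → ℝ → Cfg N × Spin N := fun κ σ N p t => let K := sSup {k : ℕ | rinst κ σ N p k ≤ ENNReal.ofReal t};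 (S (t - (rinst κ σ N p K).toReal) N (rstate κ σ N p K).1, (rstate κ σ N p K).2); let spinLaw : (N : ℕ) → Measure (Spin N) := fun N => Measure.pi (fun _ : Fin (N + 1) => stdGaussian V3); let init : (T3 → ℝ) → (N : ℕ) → Cfg N × Spin N → Cfg N × Spin N := fun θ₀ _ p => (p.1, fun i => Real.sqrt (θ₀ (p.1 i).1) • p.2 i); ∀ κs : ℕ → ℝ, (∀ N, 0 < κs N) → Tendsto κs atTop (nhds 0) → Tendsto (fun N : ℕ => κs N * ((N : ℝ) + 1) ^ (1 / 3 : ℝ)) atTop atTop → ∀ (a₀ θ₀ : T3 → ℝ) (u₀ : T3 → V3), Continuous a₀ → Continuous θ₀ → Continuous u₀ → (∀ x, 0 < a₀ x) → (∀ x, 0 < θ₀ x) → ∃ σ₀ : ℝ, 0 < σ₀ ∧ ∀ σ : ℝ, 0 < σ → σ < σ₀ → ∀ (T : ℝ) (ρ θ : ℝ → T3 → ℝ) (u : ℝ → T3 → V3), let E4 : ℝ → T3 → ℝ := fun s y => ρ s y * (‖u s y‖ ^ 2 / 2 + 3 * θ s y); Torus.IsSmoothSpaceTimeOn (Set.Ico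 0 T) ρ → Torus.IsSmoothSpaceTimeOn (Set.Ico 0 T) u → Torus.IsSmoothSpaceTimeOn (Set.Ico 0 T) θ → (∀ t ∈ Set.Ico 0 T, ∀ x, 0 < ρ t x) → (∀ t ∈ Set.Ico 0 T, ∀ x, 0 < θ t x) → (∀ t ∈ Set.Ico 0 T, ∀ x, Torus.timeDerivWithin (Set.Ico 0 T) ρ t x + Torus.divergence (fun y => ρ t y • u t y) x = 0) → (∀ t ∈ Set.Ico 0 T, ∀ x, Torus.timeDerivWithin (Set.Ico 0 T) (fun s y => ρ s y • u s y) t x + (∑ i, Torus.partialDeriv i (fun y => (ρ t y * u t y i) • u t y) x) + Torus.gradient (fun y => hsPressure σ (ρ t y) (θ t y)) x = 0) → (∀ t ∈ Set.Ico 0 T, ∀ x, Torus.timeDerivWithin (Set.Ico 0 T) E4 t x + Torus.divergence (fun y => (E4 t y + hsPressure σ (ρ t y) (θ t y)) • u t y) x = 0) → ∀ Φ : (N : ℕ) → HardSphereFlow G (ε σ N) (N + 1), let P := fun N => localGibbsLaw σ a₀ u₀ θ₀ N (Φ N); TendstoHydroFieldsAt P Φ ρ u θ 0 → ∀ t ∈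 Set.Ico 0 T, ∀ χ : T3 → ℝ, Continuous χ → ∀ δ : ℝ, 0 < δ → let Q := fun N => (P N).prod (spinLaw N); let Z := fun N (p : Cfg N × Spin N) => (rflow (κs N) σ N (init θ₀ N p) t).1; Tendsto (fun N : ℕ => Q N {p | δ < |empiricalDensityField (Z N p) χ - ∫ x, χ x * ρ t x|}) atTop (nhds 0) ∧ Tendsto (fun N : ℕ => Q N {p | δ < ‖empiricalMomentumField (Z N p) χ - ∫ x, (χ x * ρ t x) • u t x‖}) atTop (nhds 0) ∧ Tendsto (fun N : ℕ => Q N {p | δ < |empiricalEnergyField (Z N p) χ - ∫ x, χ x * totalEnergyDensity (ρ t x) (u t x) (θ t x)|}) atTop (nhds 0)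

/-- item stmt-AtomisticToContinuum-7650 · crux · rank 6 · closed · moot by None · by planner
why it might fail: at κ_N = r(N+1)^(-1/3) the spin dice are sub-OVY (kick variance O(r) per particle per unit time, zero microscopic rate): neither FFL/LO nor OVY's Dirichlet-form step applies, the ergodic input must come from the deterministic collisions — conjunct-hard at small r.
sources: OllaVaradhanYau1993, Widom1960, ChenLevermoreLiu1994, ChapmanCowling1970, Literature.Barriers.AtomisticToContinuum.MacroErgodicityBarrier
[crux] ENDPOINT RUNG (card R3's second half, accuracy form — the Euler–Landau–Teller window read at
small r through continuous dependence of classical relaxation solutions on r, so no new PDE notion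
is needed). Same frame as KappaSwapGap; conclusion: for every t < T, continuous χ, δ > 0 and η > 0
there is r₀ > 0 such that for r ∈ (0,r₀) and N ≥ N₀(r), under P_N ⊗ γ the probability that the
χ-tested empirical density (resp. momentum, translational energy) field of R^(κ_N)_t, κ_N =
r(N+1)^(-1/3), deviates by more than δ from ∫χρ_t (resp. ∫χρ_t u_t, ∫χE_t with E = ρ(|u|²/2 + 3θ/2),
the CONJUNCT's hs-Euler solution) is ≤ η. [difficulty: open-problem] -/
@[route_item "route-AtomisticToContinuum-RoughSpheresKappaDial"]
def SmallKappaAccuracy : Prop :=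
  open Filter MeasureTheory ProbabilityTheory Literature.Analysis.FluidPDE Literature.MathematicalPhysics.KineticTheory Literature.Analysis.FunctionSpaces in let Cfg : ℕ → Type := fun N => Config (N + 1) (Fin 3) T3; let Spin : ℕ → Type := fun N => Fin (N + 1) → V3; let G := Torus.geometry (Fin 3); let ε : ℝ → ℕ → ℝ := hsDiameter; let τ : ℝ → (N : ℕ) → Cfg N → ENNReal := fun σ N z => Alexander.freeExitTime G (ε σ N) z; let S : ℝ → (N : ℕ) → Cfg N → Cfg N := fun t _ z => freeFlight G t z; let rpair : ℝ → (N : ℕ) → Fin (N + 1) → Fin (N + 1) → Cfg N × Spin N → Cfg N × Spin N := fun κ _ i j p => let z := p.1; let s := p.2; let n := G.sepVec (z i).1 (z j).1; let k := ‖n‖⁻¹ • n; let g := (z i).2 - (z j).2; let gt := g - (⟪g, k⟫_ℝ) • k; let S2 := s i + s j; let J := -((⟪g, k⟫_ℝ) • k) - (κ / (1 + κ)) • gt - (Real.sqrt κ / (1 + κ)) • cross k S2; let ds := (Real.sqrt κ / (1 + κ)) • cross k gt + (1 / (1 + κ)) • cross k (cross k S2); (Function.update (Function.update z i ((z i).1,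 (z i).2 + J)) j ((z j).1, (z j).2 - J), Function.update (Function.update s i (s i + ds)) j (s j + ds)); let rstep : ℝ → ℝ → (N : ℕ) → Cfg N × Spin N → Cfg N × Spin N := fun κ σ N p => let z' := S (τ σ N p.1).toReal N p.1; if τ σ N p.1 = ⊤ then p else if h : (Alexander.incomingPairs G (ε σ N) z').Nonempty then rpair κ N h.some.1 h.some.2 (z', p.2) else (z', p.2); let rstate : ℝ → ℝ → (N : ℕ) → Cfg N × Spin N → ℕ → Cfg N × Spin N := fun κ σ N p k => (rstep κ σ N)^[k] p; let rinst : ℝ → ℝ → (N : ℕ) → Cfg N × Spin N → ℕ → ENNReal := fun κ σ N p k => ∑ m ∈ Finset.range k, τ σ N (rstate κ σ N p m).1; let rflow : ℝ → ℝ → (N : ℕ) → Cfg N × Spin N → ℝ → Cfg N × Spin N := fun κ σ N p t => let K := sSup {k : ℕ | rinst κ σ N p k ≤ ENNReal.ofReal t}; (S (t - (rinst κ σ N p K).toReal) N (rstate κ σ N p K).1, (rstate κ σ N p K).2); let spinLaw : (N : ℕ) → Measure (Spin N) := fun N => Measure.pi (fun _ : Fin (N + 1) => stdGaussian V3); let init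 : (T3 → ℝ) → (N : ℕ) → Cfg N × Spin N → Cfg N × Spin N := fun θ₀ _ p => (p.1, fun i => Real.sqrt (θ₀ (p.1 i).1) • p.2 i); ∀ (a₀ θ₀ : T3 → ℝ) (u₀ : T3 → V3), Continuous a₀ → Continuous θ₀ → Continuous u₀ → (∀ x, 0 < a₀ x) → (∀ x, 0 < θ₀ x) → ∃ σ₀ : ℝ, 0 < σ₀ ∧ ∀ σ : ℝ, 0 < σ → σ < σ₀ → ∀ (T : ℝ) (ρ θ : ℝ → T3 → ℝ) (u : ℝ → T3 → V3), IsHardSphereEulerSolution σ T ρ u θ → ∀ Φ : (N : ℕ) → HardSphereFlow G (ε σ N) (N + 1), let P := fun N => localGibbsLaw σ a₀ u₀ θ₀ N (Φ N); TendstoHydroFieldsAt P Φ ρ u θ 0 → ∀ t ∈ Set.Ico 0 T, ∀ χ : T3 → ℝ, Continuous χ → ∀ δ : ℝ, 0 < δ → ∀ η : ℝ, 0 < η → ∃ r₀ : ℝ, 0 < r₀ ∧ ∀ r : ℝ, 0 < r → r < r₀ → ∃ N₀ : ℕ, ∀ N : ℕ, N₀ ≤ N → let Q := (P N).prod (spinLaw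 N); let Z := fun p : Cfg N × Spin N => (rflow (r * ((N : ℝ) + 1) ^ (-(1 / 3 : ℝ))) σ N (init θ₀ N p) t).1; Q {p | δ < |empiricalDensityField (Z p) χ - ∫ x, χ x * ρ t x|} ≤ ENNReal.ofReal η ∧ Q {p | δ < ‖empiricalMomentumField (Z p) χ - ∫ x, (χ x * ρ t x) • u t x‖} ≤ ENNReal.ofReal η ∧ Q {p | δ < |empiricalEnergyField (Z p) χ - ∫ x, χ x * totalEnergyDensity (ρ t x) (u t x) (θ t x)|} ≤ ENNReal.ofReal η

-- item stmt-AtomisticToContinuum-7941 · support · rank 3 · closed · moot by None · by planner — informal only, no Lean statement yet: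
--   [crux] SPIN CHAOS (card crux 1; the engine of the analogue rungs; informal until definition request
--   D1 — the RoughSphereFlow API with its empirical collision/spin measures — lands, then typed by
--   set-signature). Rough-sphere gas on 𝕋³ (Bryan's rule as in KappaSwapGap's let block), reduced
--   density σ < σ₀, rough local Gibbs data (thermal spins at θ₀), pre-shock horizon [0,t]. (a) FIXED κ ∈
--   (0,2/3] (feeds RoughEulerFixedKappa): for mesoscopic space-time cells (side ℓ_N, N^(-1/3) ≪ ℓ_N ≪ 1;
--   duration M mean free times) the empirical joint law of (incoming normalised pair data (k, g), s_i,
--   s_j) over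

-- item stmt-AtomisticToContinuum-7948 · support · rank 4 · closed · moot by None · by planner — informal only, no Lean statement yet:
--   [crux] MACRO-ERGODICITY OF THE CONTACT-LANGEVIN HARD-SPHERE GAS (card crux 2; the
--   FritzFunakiLebowitz1994 / LiveraniOlla1996 theorem for a conservative noise living on contacts;
--   informal until D2 ContactLangevinGas and D3 RegularStationaryState land). Infinite-volume hard
--   spheres (diameter 1, reduced density < η₀) under Alexander's a.s. dynamics in which, at each binary
--   contact with unit normal k, incoming relative velocity g (tangential part g_t), the pair receives
--   the impulse ±J with J = −(g·k)k − κ(1+κ)⁻¹ g_t − √κ(1+κ)⁻¹ k × Σ, Σ ~ N(0, 2θ_b·Id) drawn afresh at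
--   every contact (the spin-margi

/-- item stmt-AtomisticToContinuum-7651 · support · rank 9 · closed · moot by None · by planner
sources: ChapmanCowling1970, CondiffLuDahler1965, OllaVaradhanYau1993, FritzFunakiLebowitz1994, CoxFeres2016
[support] ANALOGUE THEOREM AT FIXED ROUGHNESS (card rung R1; support — it does not drive staffing,
VanishingKappaEuler does): for every κ ∈ (0, 2/3] and continuous profiles ∃ σ₀ ∀ σ < σ₀: γ = 4/3
hard-sphere Euler (inline clauses as in VanishingKappaEuler) from the deterministic rough-sphere
flow R^κ with rough local Gibbs data, pre-shock, convergence in probability of density, momentum and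
translational-energy fields (the latter to ρ(|u|²/2 + 3θ/2)). Expected proof: SpinChaos (fixed-κ
form) ⇒ contact-Langevin reduction ⇒ ContactLangevinErgodicity ⇒ OVY §4 (C)–(E) + relative-entropy
bookkeeping with contact currents, EOS from the conjunct's statics (VirialEosIdentification 0782,
LocalGibbsConcentration 0767 apply verbatim: same excluded volume). [difficulty: open-problem] -/
@[route_item "route-AtomisticToContinuum-RoughSpheresKappaDial"]
def RoughEulerFixedKappa : Prop :=
  open Filter MeasureTheory ProbabilityTheory Literature.Analysis.FluidPDE Literature.MathematicalPhysics.KineticTheory Literature.Analysis.FunctionSpaces in let Cfg : ℕ → Type := fun N => Config (N + 1) (Fin 3) T3; let Spin : ℕ → Type := fun N => Fin (N + 1) → V3; let G := Torus.geometry (Fin 3); let ε : ℝ → ℕ → ℝ := hsDiameter; let τ : ℝ → (N : ℕ) → Cfg N → ENNReal := fun σ N z => Alexander.freeExitTime G (ε σ N) z; let S : ℝ → (N : ℕ) → Cfg N → Cfg N := fun t _ z => freeFlight G t z; let rpair : ℝ → (N : ℕ) → Fin (N + 1) → Fin (N + 1) → Cfg N × Spin N → Cfg N × Spin N := fun κ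 _ i j p => let z := p.1; let s := p.2; let n := G.sepVec (z i).1 (z j).1; let k := ‖n‖⁻¹ • n; let g := (z i).2 - (z j).2; let gt := g - (⟪g, k⟫_ℝ) • k; let S2 := s i + s j; let J := -((⟪g, k⟫_ℝ) • k) - (κ / (1 + κ)) • gt - (Real.sqrt κ / (1 + κ)) • cross k S2; let ds := (Real.sqrt κ / (1 + κ)) • cross k gt + (1 / (1 + κ)) • cross k (cross k S2); (Function.update (Function.update z i ((z i).1, (z i).2 + J)) j ((z j).1, (z j).2 - J), Function.update (Function.update s i (s i + ds)) j (s j + ds)); let rstep : ℝ → ℝ → (N : ℕ) → Cfg N × Spin N → Cfg N × Spin N := fun κ σ N p => let z' := S (τ σ N p.1).toReal N p.1; if τ σ N p.1 = ⊤ then p else if h : (Alexander.incomingPairs G (ε σ N) z').Nonempty then rpair κ N h.some.1 h.some.2 (z', p.2) else (z', p.2); let rstate : ℝ → ℝ → (N : ℕ) → Cfg N × Spin N → ℕ → Cfg N × Spin N := fun κ σ N p k => (rstep κ σ N)^[k] p; let rinst : ℝ → ℝ → (N : ℕ) → Cfg N × Spin N → ℕ → ENNReal := fun κ σ N p k =>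 ∑ m ∈ Finset.range k, τ σ N (rstate κ σ N p m).1; let rflow : ℝ → ℝ → (N : ℕ) → Cfg N × Spin N → ℝ → Cfg N × Spin N := fun κ σ N p t => let K := sSup {k : ℕ | rinst κ σ N p k ≤ ENNReal.ofReal t}; (S (t - (rinst κ σ N p K).toReal) N (rstate κ σ N p K).1, (rstate κ σ N p K).2); let spinLaw : (N : ℕ) → Measure (Spin N) := fun N => Measure.pi (fun _ : Fin (N + 1) => stdGaussian V3); let init : (T3 → ℝ) → (N : ℕ) → Cfg N × Spin N → Cfg N × Spin N := fun θ₀ _ p => (p.1, fun i => Real.sqrt (θ₀ (p.1 i).1) • p.2 i); ∀ κ : ℝ, 0 < κ → κ ≤ 2 / 3 → ∀ (a₀ θ₀ : T3 → ℝ) (u₀ : T3 → V3), Continuous a₀ → Continuous θ₀ → Continuous u₀ → (∀ x, 0 < a₀ x) → (∀ x, 0 < θ₀ x) → ∃ σ₀ : ℝ, 0 < σ₀ ∧ ∀ σ : ℝ, 0 < σ → σ < σ₀ → ∀ (T : ℝ) (ρ θ : ℝ → T3 → ℝ) (u : ℝ → T3 → V3), let E4 : ℝ → T3 → ℝ :=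 fun s y => ρ s y * (‖u s y‖ ^ 2 / 2 + 3 * θ s y); Torus.IsSmoothSpaceTimeOn (Set.Ico 0 T) ρ → Torus.IsSmoothSpaceTimeOn (Set.Ico 0 T) u → Torus.IsSmoothSpaceTimeOn (Set.Ico 0 T) θ → (∀ t ∈ Set.Ico 0 T, ∀ x, 0 < ρ t x) → (∀ t ∈ Set.Ico 0 T, ∀ x, 0 < θ t x) → (∀ t ∈ Set.Ico 0 T, ∀ x, Torus.timeDerivWithin (Set.Ico 0 T) ρ t x + Torus.divergence (fun y => ρ t y • u t y) x = 0) → (∀ t ∈ Set.Ico 0 T, ∀ x, Torus.timeDerivWithin (Set.Ico 0 T) (fun s y => ρ s y • u s y) t x + (∑ i, Torus.partialDeriv i (fun y => (ρ t y * u t y i) • u t y) x) + Torus.gradient (fun y => hsPressure σ (ρ t y) (θ t y)) x = 0) → (∀ t ∈ Set.Ico 0 T, ∀ x, Torus.timeDerivWithin (Set.Ico 0 T) E4 t x + Torus.divergence (fun y => (E4 t y + hsPressure σ (ρ t y) (θ t y)) • u t y) x = 0) → ∀ Φ : (N : ℕ) → HardSphereFlow G (ε σ N) (N + 1), let P :=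 fun N => localGibbsLaw σ a₀ u₀ θ₀ N (Φ N); TendstoHydroFieldsAt P Φ ρ u θ 0 → ∀ t ∈ Set.Ico 0 T, ∀ χ : T3 → ℝ, Continuous χ → ∀ δ : ℝ, 0 < δ → let Q := fun N => (P N).prod (spinLaw N); let Z := fun N (p : Cfg N × Spin N) => (rflow κ σ N (init θ₀ N p) t).1; Tendsto (fun N : ℕ => Q N {p | δ < |empiricalDensityField (Z N p) χ - ∫ x, χ x * ρ t x|}) atTop (nhds 0) ∧ Tendsto (fun N : ℕ => Q N {p | δ < ‖empiricalMomentumField (Z N p) χ - ∫ x, (χ x * ρ t x) • u t x‖}) atTop (nhds 0) ∧ Tendsto (fun N : ℕ => Q N {p | δ < |empiricalEnergyField (Z N p) χ - ∫ x, χ x * totalEnergyDensity (ρ t x) (u t x) (θ t x)|}) atTop (nhds 0)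

/-- item stmt-AtomisticToContinuum-7652 · support · rank 9 · closed · moot by None · by planner
sources: CIP1994, GST2013, ChapmanCowling1970, CoxFeres2016
[support] ALEXANDER'S THEOREM FOR THE ROUGH FLOW (every κ ≥ 0, 0 < σ < 1/2, every N): (a) p ↦ R^κ_t
p is measurable for each t; (b) for Liouville ⊗ Lebesgue-a.e. (z, s) every finite exit configuration
of the rough recursion is a simple incoming collision, no pair touches strictly inside a free
flight, and the exit times sum to ∞ (the three `FwdGood` clauses for rstate); (c) R^κ_t preserves
Liouville ⊗ Lebesgue(spins) for t ≥ 0. Same proof as `torusFlow_ae_good_holds` /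
`torusFlow_measurePreserving_holds` (CIP1994 App. 4.A): the rule is a linear isometry of
(v_i,v_j,s_i,s_j) reversing g·k, so it maps the incoming flux measure |g·k| dS dv ds onto the
outgoing one; note the map is DIScontinuous at grazing (ChapmanCowling1970 §11.8), which the measure
argument does not mind. [difficulty: M] -/
@[route_item "route-AtomisticToContinuum-RoughSpheresKappaDial"]
def RoughWellPosed : Prop :=
  open Filter MeasureTheory ProbabilityTheory Literature.Analysis.FluidPDE Literature.MathematicalPhysics.KineticTheory Literature.Analysis.FunctionSpaces in let Cfg : ℕ → Type := fun N => Config (N + 1) (Fin 3) T3; let Spin : ℕ → Type := fun N => Fin (N + 1) → V3; let G := Torus.geometry (Fin 3); let ε : ℝ → ℕ → ℝ := hsDiameter; let τ : ℝ → (N : ℕ) → Cfg N → ENNReal := fun σ N z => Alexander.freeExitTime G (ε σ N) z; let S : ℝ → (N : ℕ) → Cfg N → Cfg N := fun t _ z => freeFlight G t z; let rpair : ℝ → (N : ℕ) → Fin (N + 1) → Fin (N + 1) → Cfg N × Spin N → Cfg N × Spin N := fun κ _ i j p => let z := p.1; let s := p.2; let n := G.sepVec (z i).1 (z j).1; let k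 := ‖n‖⁻¹ • n; let g := (z i).2 - (z j).2; let gt := g - (⟪g, k⟫_ℝ) • k; let S2 := s i + s j; let J := -((⟪g, k⟫_ℝ) • k) - (κ / (1 + κ)) • gt - (Real.sqrt κ / (1 + κ)) • cross k S2; let ds := (Real.sqrt κ / (1 + κ)) • cross k gt + (1 / (1 + κ)) • cross k (cross k S2); (Function.update (Function.update z i ((z i).1, (z i).2 + J)) j ((z j).1, (z j).2 - J), Function.update (Function.update s i (s i + ds)) j (s j + ds)); let rstep : ℝ → ℝ → (N : ℕ) → Cfg N × Spin N → Cfg N × Spin N := fun κ σ N p => let z' := S (τ σ N p.1).toReal N p.1; if τ σ N p.1 = ⊤ then p else if h : (Alexander.incomingPairs G (ε σ N) z').Nonempty then rpair κ N h.some.1 h.some.2 (z', p.2) else (z', p.2); let rstate : ℝ → ℝ → (N : ℕ) → Cfg N × Spin N → ℕ → Cfg N × Spin N := fun κ σ N p k => (rstep κ σ N)^[k] p; let rinst : ℝ → ℝ → (N : ℕ) → Cfg N × Spin N → ℕ → ENNReal := fun κ σ N p k => ∑ m ∈ Finset.range k, τ σ N (rstate κ σ N p m).1; let rflow : ℝ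 → ℝ → (N : ℕ) → Cfg N × Spin N → ℝ → Cfg N × Spin N := fun κ σ N p t => let K := sSup {k : ℕ | rinst κ σ N p k ≤ ENNReal.ofReal t}; (S (t - (rinst κ σ N p K).toReal) N (rstate κ σ N p K).1, (rstate κ σ N p K).2); ∀ κ : ℝ, 0 ≤ κ → ∀ σ : ℝ, 0 < σ → σ < 2⁻¹ → ∀ N : ℕ, let μ : Measure (Cfg N × Spin N) := (liouville G (N + 1) (ε σ N)).prod volume; (∀ t : ℝ, Measurable (fun p : Cfg N × Spin N => rflow κ σ N p t)) ∧ (∀ᵐ p ∂μ, (let L := rstate κ σ N p; (∀ k, τ σ N (L k).1 ≠ ⊤ → Alexander.IsSimpleIncoming G (ε σ N) (S (τ σ N (L k).1).toReal N (L k).1)) ∧ (∀ k (s : ℝ), 0 < s → ENNReal.ofReal s < τ σ N (L k).1 → ∀ i j : Fin (N + 1), i ≠ j → S s N (L k).1 ∉ contactSet G (N + 1) (ε σ N) i j) ∧ ∑' k, τ σ N (L k).1 = ⊤)) ∧ (∀ t : ℝ, 0 ≤ t → MeasurePreserving (fun p : Cfg N × Spin N => rflow κ σ N p t) μ μ)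

/-- item stmt-AtomisticToContinuum-7653 · support · rank 9 · closed · moot by None · by planner
sources: CIP1994, ChapmanCowling1970
[support] UNIT TEST OF THE DIAL'S ENDPOINT (provable now, by unfolding and induction on the
collision index): at κ = 0 the typed rule is J = −(g·k)k = `collidePair` on the translational
variables and the spin update does not feed back, so the translational projection of R^0 is the
library's `Alexander.fwdFlow` for every σ, N, initial (z, s) and t (same branching on `freeExitTime
= ⊤` / `incomingPairs`, same `Set.Nonempty.some`). [difficulty: provable-now] -/
@[route_item "route-AtomisticToContinuum-RoughSpheresKappaDial"]
def KappaZeroReduction : Prop :=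
  open Filter MeasureTheory ProbabilityTheory Literature.Analysis.FluidPDE Literature.MathematicalPhysics.KineticTheory Literature.Analysis.FunctionSpaces in let Cfg : ℕ → Type := fun N => Config (N + 1) (Fin 3) T3; let Spin : ℕ → Type := fun N => Fin (N + 1) → V3; let G := Torus.geometry (Fin 3); let ε : ℝ → ℕ → ℝ := hsDiameter; let τ : ℝ → (N : ℕ) → Cfg N → ENNReal := fun σ N z => Alexander.freeExitTime G (ε σ N) z; let S : ℝ → (N : ℕ) → Cfg N → Cfg N := fun t _ z => freeFlight G t z; let rpair : ℝ → (N : ℕ) → Fin (N + 1) → Fin (N + 1) → Cfg N × Spin N → Cfg N × Spin N := fun κ _ i j p => let z := p.1; let s := p.2; let n := G.sepVec (z i).1 (z j).1; let k := ‖n‖⁻¹ • n; let g := (z i).2 - (z j).2; let gt := g - (⟪g, k⟫_ℝ) • k; let S2 := s i + s j; let J := -((⟪g, k⟫_ℝ) • k) - (κ / (1 + κ)) • gt - (Real.sqrt κ / (1 + κ)) • cross k S2; let ds := (Real.sqrt κ / (1 + κ)) • cross k gt + (1 / (1 + κ)) • cross k (cross k S2); (Function.update (Function.update z i ((z i).1,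 (z i).2 + J)) j ((z j).1, (z j).2 - J), Function.update (Function.update s i (s i + ds)) j (s j + ds)); let rstep : ℝ → ℝ → (N : ℕ) → Cfg N × Spin N → Cfg N × Spin N := fun κ σ N p => let z' := S (τ σ N p.1).toReal N p.1; if τ σ N p.1 = ⊤ then p else if h : (Alexander.incomingPairs G (ε σ N) z').Nonempty then rpair κ N h.some.1 h.some.2 (z', p.2) else (z', p.2); let rstate : ℝ → ℝ → (N : ℕ) → Cfg N × Spin N → ℕ → Cfg N × Spin N := fun κ σ N p k => (rstep κ σ N)^[k] p; let rinst : ℝ → ℝ → (N : ℕ) → Cfg N × Spin N → ℕ → ENNReal := fun κ σ N p k => ∑ m ∈ Finset.range k, τ σ N (rstate κ σ N p m).1; let rflow : ℝ → ℝ → (N : ℕ) → Cfg N × Spin N → ℝ → Cfg N × Spin N := fun κ σ N p t => let K := sSup {k : ℕ | rinst κ σ N p k ≤ ENNReal.ofReal t}; (S (t - (rinst κ σ N p K).toReal) N (rstate κ σ N p K).1, (rstate κ σ N p K).2); ∀ (σ : ℝ) (N : ℕ) (p : Cfg N × Spin N) (t : ℝ), (rflow 0 σ N p t).1 = Alexander.fwdFlow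 G (ε σ N) p.1 t

-- item stmt-AtomisticToContinuum-7965 · support · rank 9 · closed · moot by None · by planner — informal only, no Lean statement yet:
--   [support] THE TWO-TEMPERATURE WINDOW (card crux 3 / rung R2 — Euler–Landau–Teller hydrodynamics from
--   Newton, new even as a conjecture; informal until D4 IsLandauTellerEulerSolution lands; the intended
--   layer-2 parent of SmallKappaAccuracy together with continuous dependence of classical relaxation
--   solutions on r at r = 0). Along κ_N(N+1)^(1/3) → r ∈ (0,∞), from rough local Gibbs data (θ_rot =
--   θ_tr = θ₀), pre-shock, the empirical density, momentum, translational-energy and rotational-energy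
--   (N⁻¹Σχ(x_i)|s_i|²/2) fields of the rough flow converge in probability to the classical solution of
--   ∂_tρ +

/-- item stmt-AtomisticToContinuum-7654 · assembly · rank 1 · closed · moot by None · by planner
sources: OllaVaradhanYau1993, KipnisLandim1999
[assembly] KappaSwapGap → SmallKappaAccuracy → HydrodynamicLimit. -/
@[route_item "route-AtomisticToContinuum-RoughSpheresKappaDial"]
def Assembly : Prop :=
  KappaSwapGap → SmallKappaAccuracy → Literature.MathematicalPhysics.KineticTheory.HydrodynamicLimit

end Summit.AtomisticToContinuum.HydrodynamicLimit.Theses.RoughSpheresKappaDial
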